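import Summits.Ventures.DiscreteObjects.PP12.FlagOrbitTenData

/-!
# A plain `ρ = 1` orbit matrix carries the structured `f = 10` data, II: the ten conjuncts and `NoFlagTenOrbitMatrix → NoFlagOrbitMatrix 1` (kernel)
Framing: lottery ticket; floor = certified bounds/negative ranges.

Cell pub-namedobj (venture DiscreteObjects), target (M), designs gen 15; continuation of `FlagOrbitTenData` (extraction of `φ, ψ, γ, C, β` from a plain
matrix `M` with `IsFlagOrbitMatrix 1 M`, p344983). Every conjunct of designs g12's `IsFlagTenOrbitMatrix` (p322607) is ONE row- or column-product equation
of the plain system with the entries in closed form: side·side ⇒ (R1), `φ` without 2-cycles and the `γ_j` separate `φ`-adjacent triangles; side·T-line ⇒ (R2);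
T·T ⇒ (R3) and `β k j` injective; triangle·triangle ⇒ (C1) and the `C_k` separate; triangle·T-point ⇒ (C3); T-point·T-point ⇒ (C4); `Z`·T-point ⇒ the
fibres of `γ_j` have size 3; T-row block sums ⇒ the fibres of `C_k` have size 3. Hence **`isFlagTenOrbitMatrix_tenDataOfPlain`** and
**`noFlagOrbitMatrix_one_of_noFlagTenOrbitMatrix : NoFlagTenOrbitMatrix → NoFlagOrbitMatrix 1`** — together with `FlagOrbitBridgeSeven`-style inclusion
the other way (`FlagOrbitReduction` proves both reductions from the plane anyway) the plain and the structured `f = 10` statements are interchangeable for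
the census: the verdict for `NoFlagTenOrbitMatrix` (decided EMPTY outside the kernel by designs g11 + g12, referee police g110) transfers to
`NoFlagOrbitMatrix 1`. Nothing here decides either statement in the kernel. No `sorry`, no new axioms.
-/

namespace Summit.Ventures.DiscreteObjects.PP12

open Finset
open scoped Classical

namespace IsFlagOrbitMatrix

variable {M : FRow 1 → FCol 1 → ℕ}

/-! ### Row and column products in closed form -/

/-- side · side (distinct triangles): `1 (Z) + 2[ψ i' = i] + 2[ψ i = i'] + #{j : γ j i = γ j i'} = 3`. -/
theorem side_side (h : IsFlagOrbitMatrix 1 M) {i i' : Fin 12} (hii : i ≠ i') :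
    1 + (2 * (if psi h i' = i then 1 else 0) + 2 * (if psi h i = i' then 1 else 0))
      + (univ.filter fun j : Fin 9 => gam h j i = gam h j i').card = 3 := by
  have hp := h.2.2.1 (sd i) (sd i')
  have ht : FlagOrbit.rowTarget (sd i) (sd i') = 3 := by
    simp [FlagOrbit.rowTarget, hii]
  rw [ht, row_product_split, sd_zc h, sd_zc h] at hp
  -- triangle block
  have htri : ∑ i'' : Fin 12, M (sd i) (tr i'') * M (sd i') (tr i'') = 2 * (if psi h i' = i then 1 else 0) + 2 * (if psi h i = i' then 1 else 0) := by
    rw [Finset.sum_congr rfl (fun i'' _ => by rw [sd_tr_eq h i i'', sd_tr_eq h i' i''])]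
    rw [← Finset.add_sum_erase univ _ (mem_univ i), if_pos rfl, if_neg hii]
    rw [← Finset.add_sum_erase _ _ (mem_erase.2 ⟨hii.symm, mem_univ i'⟩), if_neg hii.symm, if_pos rfl]
    have hrest : ∑ x ∈ (univ.erase i).erase i', (if x = i then 2 else if x = psi h i then 1 else 0) * (if x = i' then 2 else if x = psi h i' then 1 else 0) = 0 := by
      refine Finset.sum_eq_zero fun x hx => ?_
      have hx1 : x ≠ i' := ne_of_mem_erase hx
      have hx2 : x ≠ i := ne_of_mem_erase (mem_of_mem_erase hx)
      rw [if_neg hx2, if_neg hx1]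
      by_cases e1 : x = psi h i
      · by_cases e2 : x = psi h i'
        · -- ψ i = ψ i' with i ≠ i' contradicts injectivity of ψ
          exfalso; apply hii
          have := congrArg (phi h) (e1.symm.trans e2)
          rwa [phi_psi, phi_psi] at this
        · rw [if_neg e2, mul_zero]
      · rw [if_neg e1, zero_mul]
    rw [hrest, add_zero]
    have e1 : (if i = psi h i' then 1 else 0) = (if psi h i' = i then 1 else 0 : ℕ) := by
      by_cases e : i = psi h i' <;> simp [e, eq_comm]
    have e2 : (if i' = psi h i then 1 else 0) = (if psi h i = i' then 1 else 0 : ℕ) := by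
      by_cases e : i' = psi h i <;> simp [e, eq_comm]
    rw [e1, e2]; ring
  -- T-point block
  have htp : ∑ jt : Fin 9 × Fin 4, M (sd i) (tp jt.1 jt.2) * M (sd i') (tp jt.1 jt.2) = (univ.filter fun j : Fin 9 => gam h j i = gam h j i').card := by
    rw [Fintype.sum_prod_type]
    rw [Finset.card_eq_sum_ones, Finset.sum_filter]
    refine Finset.sum_congr rfl fun j _ => ?_
    rw [Finset.sum_congr rfl (fun t _ => by rw [sd_tp_eq h i j t, sd_tp_eq h i' j t])]
    by_cases e : gam h j i = gam h j i'
    · rw [if_pos e, Finset.sum_eq_single (gam h j i)]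
      · rw [if_pos rfl, ← e, if_pos rfl]
      · intro t _ ht; rw [if_neg (fun e' => ht e'.symm), zero_mul]
      · intro hh; exact absurd (mem_univ _) hh
    · rw [if_neg e]
      refine Finset.sum_eq_zero fun t _ => ?_
      by_cases e1 : gam h j i = t
      · rw [if_pos e1, if_neg (fun e2 => e (e1.trans e2.symm)), mul_zero]
      · rw [if_neg e1, zero_mul]
  rw [htri, htp] at hp
  omega

/-- side · T-line: `2[C k i = t] + [C k (ψ i) = t] + #{j : β k j t = γ j i} = 3` ((R2)). -/
theorem side_tline (h : IsFlagOrbitMatrix 1 M) (i : Fin 12) (k : Fin 9) (t : Fin 4) :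
    (2 * (if cee h k i = t then 1 else 0) + (if cee h k (psi h i) = t then 1 else 0))
      + (univ.filter fun j : Fin 9 => bet h k j t = gam h j i).card = 3 := by
  have hp := h.2.2.1 (sd i) (tl k t)
  have ht : FlagOrbit.rowTarget (sd i) (tl k t) = 3 := rfl
  rw [ht, row_product_split, tl_zc h, mul_zero, zero_add] at hp
  obtain ⟨hψne, -, -⟩ := psi_spec h i
  have htri : ∑ i'' : Fin 12, M (sd i) (tr i'') * M (tl k t) (tr i'')
      = 2 * (if cee h k i = t then 1 else 0) + (if cee h k (psi h i) = t then 1 else 0) := by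
    rw [Finset.sum_congr rfl (fun i'' _ => by rw [sd_tr_eq h i i'', tl_tr_eq h k t i''])]
    rw [← Finset.add_sum_erase univ _ (mem_univ i), if_pos rfl]
    rw [← Finset.add_sum_erase _ _ (mem_erase.2 ⟨hψne, mem_univ _⟩), if_neg hψne, if_pos rfl, one_mul]
    have hrest : ∑ x ∈ (univ.erase i).erase (psi h i),
        (if x = i then 2 else if x = psi h i then 1 else 0) * (if cee h k x = t then 1 else 0) = 0 := by
      refine Finset.sum_eq_zero fun x hx => ?_
      rw [if_neg (ne_of_mem_erase (mem_of_mem_erase hx)), if_neg (ne_of_mem_erase hx), zero_mul]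
    rw [hrest, add_zero]
  have htp : ∑ jt : Fin 9 × Fin 4, M (sd i) (tp jt.1 jt.2) * M (tl k t) (tp jt.1 jt.2)
      = (univ.filter fun j : Fin 9 => bet h k j t = gam h j i).card := by
    rw [Fintype.sum_prod_type, Finset.card_eq_sum_ones, Finset.sum_filter]
    refine Finset.sum_congr rfl fun j _ => ?_
    rw [Finset.sum_congr rfl (fun t' _ => by rw [sd_tp_eq h i j t', tl_tp_eq h k t j t', ite_zero_mul_ite_zero, mul_one])]
    by_cases e : bet h k j t = gam h j i
    · rw [if_pos e, Finset.sum_eq_single (gam h j i)]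
      · rw [if_pos ⟨rfl, e⟩]
      · intro t' _ ht'; exact if_neg (fun hh => ht' hh.1.symm)
      · intro hh; exact absurd (mem_univ _) hh
    · rw [if_neg e]
      exact Finset.sum_eq_zero fun t' _ => if_neg (fun hh => e (hh.2.trans hh.1.symm))
  rw [htri, htp] at hp
  omega

/-- T-line · T-line through different fixed points: `#{i : C k i = t ∧ C k' i = t'} + #{j : β k j t = β k' j t'} = 3` ((R3)). -/
theorem tline_tline (h : IsFlagOrbitMatrix 1 M) {k k' : Fin 9} (hkk : k ≠ k') (t t' : Fin 4) :
    (univ.filter fun i : Fin 12 => cee h k i = t ∧ cee h k' i = t').card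
      + (univ.filter fun j : Fin 9 => bet h k j t = bet h k' j t').card = 3 := by
  have hp := h.2.2.1 (tl k t) (tl k' t')
  have ht : FlagOrbit.rowTarget (tl k t) (tl k' t') = 3 := by
    simp [FlagOrbit.rowTarget, hkk]
  rw [ht, row_product_split, tl_zc h, zero_mul, zero_add] at hp
  have htri : ∑ i : Fin 12, M (tl k t) (tr i) * M (tl k' t') (tr i) = (univ.filter fun i : Fin 12 => cee h k i = t ∧ cee h k' i = t').card := by
    rw [Finset.card_eq_sum_ones, Finset.sum_filter]
    exact Finset.sum_congr rfl fun i _ => by rw [tl_tr_eq h k t i, tl_tr_eq h k' t' i, ite_zero_mul_ite_zero, mul_one]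
  have htp : ∑ jt : Fin 9 × Fin 4, M (tl k t) (tp jt.1 jt.2) * M (tl k' t') (tp jt.1 jt.2)
      = (univ.filter fun j : Fin 9 => bet h k j t = bet h k' j t').card := by
    rw [Fintype.sum_prod_type, Finset.card_eq_sum_ones, Finset.sum_filter]
    refine Finset.sum_congr rfl fun j _ => ?_
    rw [Finset.sum_congr rfl (fun t'' _ => by rw [tl_tp_eq h k t j t'', tl_tp_eq h k' t' j t'', ite_zero_mul_ite_zero, mul_one])]
    by_cases e : bet h k j t = bet h k' j t'
    · rw [if_pos e, Finset.sum_eq_single (bet h k j t)]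
      · rw [if_pos ⟨rfl, e.symm⟩]
      · intro t'' _ ht''; exact if_neg (fun hh => ht'' hh.1.symm)
      · intro hh; exact absurd (mem_univ _) hh
    · rw [if_neg e]
      exact Finset.sum_eq_zero fun t'' _ => if_neg (fun hh => e (hh.1.trans hh.2.symm))
  rw [htri, htp] at hp
  exact hp

/-- T-lines through the same fixed point are orthogonal: `β k j` is injective. -/
theorem bet_injective (h : IsFlagOrbitMatrix 1 M) (k j : Fin 9) : Function.Injective (bet h k j) := by
  intro t t' htt
  by_contra hne
  have h0 := entry_mul_eq_zero_of_rows h (r₁ := tl k t) (r₂ := tl k t') (by simp [FlagOrbit.rowTarget, hne]) (tp j (bet h k j t))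
  rw [tl_tp_eq h k t j, tl_tp_eq h k t' j, if_pos rfl, if_pos htt.symm] at h0
  exact absurd h0 (by norm_num)

/-- triangle · triangle (distinct): `1 + 2[φ i' = i] + 2[φ i = i'] + #{k : C k i = C k i'} = 3` ((C1)). -/
theorem tri_tri (h : IsFlagOrbitMatrix 1 M) {i i' : Fin 12} (hii : i ≠ i') :
    1 + (2 * (if phi h i' = i then 1 else 0) + 2 * (if phi h i = i' then 1 else 0))
      + (univ.filter fun k : Fin 9 => cee h k i = cee h k i').card = 3 := by
  have hp := h.2.2.2.1 (tr i) (tr i')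
  have ht : FlagOrbit.colTarget (tr i) (tr i') = 3 := by
    simp [FlagOrbit.colTarget, hii]
  rw [ht, col_product_split, gr_tr h, gr_tr h] at hp
  -- side block, in terms of φ: M (side i'') (tri i) = 2[i'' = i] + [i'' = φ i]
  have hsd : ∀ i'' i₀ : Fin 12, M (sd i'') (tr i₀) = if i'' = i₀ then 2 else if i'' = phi h i₀ then 1 else 0 := by
    intro i'' i₀
    rw [sd_tr_eq h i'' i₀]
    by_cases e : i'' = i₀
    · rw [if_pos e.symm, if_pos e]
    · rw [if_neg (fun e' => e e'.symm), if_neg e]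
      by_cases e2 : i'' = phi h i₀
      · rw [if_pos e2, e2, psi_phi, if_pos rfl]
      · rw [if_neg e2, if_neg]
        intro e3; apply e2; rw [e3, phi_psi]
  have hside : ∑ i'' : Fin 12, M (sd i'') (tr i) * M (sd i'') (tr i')
      = 2 * (if phi h i' = i then 1 else 0) + 2 * (if phi h i = i' then 1 else 0) := by
    rw [Finset.sum_congr rfl (fun i'' _ => by rw [hsd i'' i, hsd i'' i'])]
    obtain ⟨hφne, -⟩ := phi_spec h i
    rw [← Finset.add_sum_erase univ _ (mem_univ i), if_pos rfl, if_neg hii]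
    rw [← Finset.add_sum_erase _ _ (mem_erase.2 ⟨hii.symm, mem_univ i'⟩), if_neg hii.symm, if_pos rfl]
    have hrest : ∑ x ∈ (univ.erase i).erase i', (if x = i then 2 else if x = phi h i then 1 else 0) * (if x = i' then 2 else if x = phi h i' then 1 else 0) = 0 := by
      refine Finset.sum_eq_zero fun x hx => ?_
      have hx1 : x ≠ i' := ne_of_mem_erase hx
      have hx2 : x ≠ i := ne_of_mem_erase (mem_of_mem_erase hx)
      rw [if_neg hx2, if_neg hx1]
      by_cases e1 : x = phi h i
      · by_cases e2 : x = phi h i'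
        · exfalso; apply hii
          have := congrArg (psi h) (e1.symm.trans e2)
          rwa [psi_phi, psi_phi] at this
        · rw [if_neg e2, mul_zero]
      · rw [if_neg e1, zero_mul]
    rw [hrest, add_zero]
    have e1 : (if i = phi h i' then 1 else 0) = (if phi h i' = i then 1 else 0 : ℕ) := by
      by_cases e : i = phi h i' <;> simp [e, eq_comm]
    have e2 : (if i' = phi h i then 1 else 0) = (if phi h i = i' then 1 else 0 : ℕ) := by
      by_cases e : i' = phi h i <;> simp [e, eq_comm]
    rw [e1, e2]; ring
  have hT : ∑ kt : Fin 9 × Fin 4, M (tl kt.1 kt.2) (tr i) * M (tl kt.1 kt.2) (tr i') = (univ.filter fun k : Fin 9 => cee h k i = cee h k i').card := by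
    rw [Fintype.sum_prod_type, Finset.card_eq_sum_ones, Finset.sum_filter]
    refine Finset.sum_congr rfl fun k _ => ?_
    rw [Finset.sum_congr rfl (fun t _ => by rw [tl_tr_eq h k t i, tl_tr_eq h k t i', ite_zero_mul_ite_zero, mul_one])]
    by_cases e : cee h k i = cee h k i'
    · rw [if_pos e, Finset.sum_eq_single (cee h k i)]
      · rw [if_pos ⟨rfl, e.symm⟩]
      · intro t _ ht; exact if_neg (fun hh => ht hh.1.symm)
      · intro hh; exact absurd (mem_univ _) hh
    · rw [if_neg e]
      exact Finset.sum_eq_zero fun t _ => if_neg (fun hh => e (hh.1.trans hh.2.symm))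
  rw [hside, hT] at hp
  omega

/-- triangle · T-point orbit: `2[γ j i = t] + [γ j (φ i) = t] + #{k : β k j (C k i) = t} = 3` ((C3)). -/
theorem tri_tpt (h : IsFlagOrbitMatrix 1 M) (i : Fin 12) (j : Fin 9) (t : Fin 4) :
    (2 * (if gam h j i = t then 1 else 0) + (if gam h j (phi h i) = t then 1 else 0))
      + (univ.filter fun k : Fin 9 => bet h k j (cee h k i) = t).card = 3 := by
  have hp := h.2.2.2.1 (tr i) (tp j t)
  have ht : FlagOrbit.colTarget (tr i) (tp j t) = 3 := rfl
  rw [ht, col_product_split, gr_tp h, mul_zero, zero_add] at hp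
  obtain ⟨hφne, -⟩ := phi_spec h i
  have hsd : ∀ i'' : Fin 12, M (sd i'') (tr i) = if i'' = i then 2 else if i'' = phi h i then 1 else 0 := by
    intro i''
    rw [sd_tr_eq h i'' i]
    by_cases e : i'' = i
    · rw [if_pos e.symm, if_pos e]
    · rw [if_neg (fun e' => e e'.symm), if_neg e]
      by_cases e2 : i'' = phi h i
      · rw [if_pos e2, e2, psi_phi, if_pos rfl]
      · rw [if_neg e2, if_neg]
        intro e3; apply e2; rw [e3, phi_psi]
  have hside : ∑ i'' : Fin 12, M (sd i'') (tr i) * M (sd i'') (tp j t)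
      = 2 * (if gam h j i = t then 1 else 0) + (if gam h j (phi h i) = t then 1 else 0) := by
    rw [Finset.sum_congr rfl (fun i'' _ => by rw [hsd i'', sd_tp_eq h i'' j t])]
    rw [← Finset.add_sum_erase univ _ (mem_univ i), if_pos rfl]
    rw [← Finset.add_sum_erase _ _ (mem_erase.2 ⟨hφne, mem_univ _⟩), if_neg hφne, if_pos rfl, one_mul]
    have hrest : ∑ x ∈ (univ.erase i).erase (phi h i),
        (if x = i then 2 else if x = phi h i then 1 else 0) * (if gam h j x = t then 1 else 0) = 0 := by
      refine Finset.sum_eq_zero fun x hx => ?_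
      rw [if_neg (ne_of_mem_erase (mem_of_mem_erase hx)), if_neg (ne_of_mem_erase hx), zero_mul]
    rw [hrest, add_zero]
  have hT : ∑ kt : Fin 9 × Fin 4, M (tl kt.1 kt.2) (tr i) * M (tl kt.1 kt.2) (tp j t)
      = (univ.filter fun k : Fin 9 => bet h k j (cee h k i) = t).card := by
    rw [Fintype.sum_prod_type, Finset.card_eq_sum_ones, Finset.sum_filter]
    refine Finset.sum_congr rfl fun k _ => ?_
    rw [Finset.sum_congr rfl (fun t' _ => by rw [tl_tr_eq h k t' i, tl_tp_eq h k t' j t, ite_zero_mul_ite_zero, mul_one])]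
    by_cases e : bet h k j (cee h k i) = t
    · rw [if_pos e, Finset.sum_eq_single (cee h k i)]
      · rw [if_pos ⟨rfl, e⟩]
      · intro t' _ ht'; exact if_neg (fun hh => ht' hh.1.symm)
      · intro hh; exact absurd (mem_univ _) hh
    · rw [if_neg e]
      refine Finset.sum_eq_zero fun t' _ => if_neg (fun hh => e ?_)
      rw [hh.1]; exact hh.2
  rw [hside, hT] at hp
  omega

/-- T-point · T-point on different fixed lines: `#{i : γ j i = t ∧ γ j' i = t'} + #{(k,t'') : β k j t'' = t ∧ β k j' t'' = t'} = 3` ((C4)). -/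
theorem tpt_tpt (h : IsFlagOrbitMatrix 1 M) {j j' : Fin 9} (hjj : j ≠ j') (t t' : Fin 4) :
    (univ.filter fun i : Fin 12 => gam h j i = t ∧ gam h j' i = t').card
      + (univ.filter fun p : Fin 9 × Fin 4 => bet h p.1 j p.2 = t ∧ bet h p.1 j' p.2 = t').card = 3 := by
  have hp := h.2.2.2.1 (tp j t) (tp j' t')
  have ht : FlagOrbit.colTarget (tp j t) (tp j' t') = 3 := by
    simp [FlagOrbit.colTarget, hjj]
  rw [ht, col_product_split, gr_tp h, zero_mul, zero_add] at hp
  have hside : ∑ i : Fin 12, M (sd i) (tp j t) * M (sd i) (tp j' t') = (univ.filter fun i : Fin 12 => gam h j i = t ∧ gam h j' i = t').card := by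
    rw [Finset.card_eq_sum_ones, Finset.sum_filter]
    exact Finset.sum_congr rfl fun i _ => by rw [sd_tp_eq h i j t, sd_tp_eq h i j' t', ite_zero_mul_ite_zero, mul_one]
  have hT : ∑ kt : Fin 9 × Fin 4, M (tl kt.1 kt.2) (tp j t) * M (tl kt.1 kt.2) (tp j' t')
      = (univ.filter fun p : Fin 9 × Fin 4 => bet h p.1 j p.2 = t ∧ bet h p.1 j' p.2 = t').card := by
    rw [Finset.card_eq_sum_ones, Finset.sum_filter]
    exact Finset.sum_congr rfl fun kt _ => by rw [tl_tp_eq h kt.1 kt.2 j t, tl_tp_eq h kt.1 kt.2 j' t', ite_zero_mul_ite_zero, mul_one]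
  rw [hside, hT] at hp
  exact hp

/-- `Z` · T-point orbit: the fibres of `γ j` have size `3`. -/
theorem gam_fibre (h : IsFlagOrbitMatrix 1 M) (j : Fin 9) (t : Fin 4) : (univ.filter fun i : Fin 12 => gam h j i = t).card = 3 := by
  have hp := h.2.2.2.1 zc (tp j t)
  have ht : FlagOrbit.colTarget zc (tp j t) = 3 := rfl
  rw [ht, col_product_split, gr_zc h, zero_mul, zero_add] at hp
  have hside : ∑ i : Fin 12, M (sd i) zc * M (sd i) (tp j t) = (univ.filter fun i : Fin 12 => gam h j i = t).card := by
    rw [Finset.card_eq_sum_ones, Finset.sum_filter]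
    exact Finset.sum_congr rfl fun i _ => by rw [sd_zc h, sd_tp_eq h i j t, one_mul]
  have hT : ∑ kt : Fin 9 × Fin 4, M (tl kt.1 kt.2) zc * M (tl kt.1 kt.2) (tp j t) = 0 :=
    Finset.sum_eq_zero fun kt _ => by rw [tl_zc h, zero_mul]
  rw [hside, hT, add_zero] at hp
  exact hp

/-- The fibres of `C k` have size `3` (T-line row block sums). -/
theorem cee_fibre (h : IsFlagOrbitMatrix 1 M) (k : Fin 9) (t : Fin 4) : (univ.filter fun i : Fin 12 => cee h k i = t).card = 3 := by
  have h3 := tri_block_sum h 0 (tl k t) (fun s hh => by cases hh)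
  rw [Finset.sum_congr rfl (fun i _ => tl_tr_eq h k t i)] at h3
  rw [Finset.card_eq_sum_ones, Finset.sum_filter]
  exact h3

/-! ### Assembly -/

/-- **A plain `ρ = 1` orbit matrix yields structured `f = 10` data satisfying all ten conjuncts of `IsFlagTenOrbitMatrix`.** -/
theorem isFlagTenOrbitMatrix_tenDataOfPlain (h : IsFlagOrbitMatrix 1 M) : IsFlagTenOrbitMatrix (tenDataOfPlain h) := by
  -- notation: the fields
  have eφ : ∀ i, (tenDataOfPlain h).φ i = phi h i := fun i => rfl
  have eψ : ∀ i, (tenDataOfPlain h).φ.symm i = psi h i := fun i => rfl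
  have eγ : (tenDataOfPlain h).γ = gam h := rfl
  have eC : (tenDataOfPlain h).C = cee h := rfl
  have eβ : ∀ k j t, (tenDataOfPlain h).β k j t = bet h k j t := fun k j t => rfl
  -- the basic relations between ψ-statements and φ-statements
  have hψφ : ∀ i i' : Fin 12, (psi h i' = i ↔ phi h i = i') := by
    intro i i'; constructor
    · intro e; rw [← e, phi_psi]
    · intro e; rw [← e, psi_phi]
  -- no 2-cycles, from side·side with i' = φ i
  have hno2 : ∀ i, phi h (phi h i) ≠ i := by
    intro i e
    obtain ⟨hφne, -⟩ := phi_spec h i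
    have hs := side_side h (i := i) (i' := phi h i) hφne.symm
    rw [psi_phi, if_pos rfl] at hs
    have : psi h i = phi h i := by
      have := congrArg (psi h) e; rw [psi_phi] at this; exact this.symm
    rw [if_pos this] at hs
    omega
  refine ⟨fun i => ⟨(phi_spec h i).1, hno2 i⟩, fun j => ⟨fun t => gam_fibre h j t, fun i => ?_⟩,
    fun k => ⟨fun t => cee_fibre h k t, fun i => ?_⟩, fun k j => (Finite.injective_iff_bijective.1 (bet_injective h k j)),
    fun i i' hii => ?_, fun i i' hii => ?_, fun k t i => ?_, fun k k' t t' hkk => ?_, fun i j t => ?_, fun j j' t t' hjj => ?_⟩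
  · -- γ j separates i and φ i
    show gam h j (phi h i) ≠ gam h j i
    obtain ⟨hφne, -⟩ := phi_spec h i
    have hs := side_side h (i := i) (i' := phi h i) hφne.symm
    rw [psi_phi, if_pos rfl] at hs
    intro e
    have hmem : j ∈ univ.filter fun j : Fin 9 => gam h j i = gam h j (phi h i) := mem_filter.2 ⟨mem_univ _, e.symm⟩
    have := Finset.card_pos.2 ⟨j, hmem⟩
    omega
  · -- C k separates i and φ i
    show cee h k (phi h i) ≠ cee h k i
    obtain ⟨hφne, -⟩ := phi_spec h i
    have hs := tri_tri h (i := i) (i' := phi h i) hφne.symm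
    rw [if_pos rfl] at hs
    intro e
    have hmem : k ∈ univ.filter fun k : Fin 9 => cee h k i = cee h k (phi h i) := mem_filter.2 ⟨mem_univ _, e.symm⟩
    have := Finset.card_pos.2 ⟨k, hmem⟩
    omega
  · -- (R1)
    show (univ.filter fun j : Fin 9 => gam h j i = gam h j i').card = if phi h i = i' ∨ phi h i' = i then 0 else 2
    have hs := side_side h hii
    by_cases h1 : phi h i = i'
    · rw [if_pos (Or.inl h1)]
      rw [if_pos ((hψφ i i').2 h1)] at hs; omega
    · by_cases h2 : phi h i' = i
      · rw [if_pos (Or.inr h2)]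
        rw [if_pos ((hψφ i' i).2 h2)] at hs; omega
      · rw [if_neg (not_or.2 ⟨h1, h2⟩)]
        rw [if_neg (fun e => h1 ((hψφ i i').1 e)), if_neg (fun e => h2 ((hψφ i' i).1 e))] at hs; omega
  · -- (C1)
    show (univ.filter fun k : Fin 9 => cee h k i = cee h k i').card = if phi h i = i' ∨ phi h i' = i then 0 else 2
    have hs := tri_tri h hii
    by_cases h1 : phi h i = i'
    · rw [if_pos (Or.inl h1)]; rw [if_pos h1] at hs; omega
    · by_cases h2 : phi h i' = i
      · rw [if_pos (Or.inr h2)]; rw [if_pos h2] at hs; omega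
      · rw [if_neg (not_or.2 ⟨h1, h2⟩)]; rw [if_neg h1, if_neg h2] at hs; omega
  · -- (R2)
    show (univ.filter fun j : Fin 9 => bet h k j t = gam h j i).card + 2 * flagInd (cee h k i = t)
        + flagInd (cee h k (psi h i) = t) = 3
    have hs := side_tline h i k t
    unfold flagInd
    have e1 : (if cee h k i = t then 1 else 0 : ℕ) = @ite ℕ (cee h k i = t) (Classical.propDecidable _) 1 0 := by congr
    have e2 : (if cee h k (psi h i) = t then 1 else 0 : ℕ) = @ite ℕ (cee h k (psi h i) = t) (Classical.propDecidable _) 1 0 := by congr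
    rw [← e1, ← e2]; omega
  · -- (R3)
    exact tline_tline h hkk t t'
  · -- (C3)
    show (univ.filter fun k : Fin 9 => bet h k j (cee h k i) = t).card + 2 * flagInd (gam h j i = t)
        + flagInd (gam h j (phi h i) = t) = 3
    have hs := tri_tpt h i j t
    unfold flagInd
    have e1 : (if gam h j i = t then 1 else 0 : ℕ) = @ite ℕ (gam h j i = t) (Classical.propDecidable _) 1 0 := by congr
    have e2 : (if gam h j (phi h i) = t then 1 else 0 : ℕ) = @ite ℕ (gam h j (phi h i) = t) (Classical.propDecidable _) 1 0 := by congr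
    rw [← e1, ← e2]; omega
  · -- (C4)
    exact tpt_tpt h hjj t t'

end IsFlagOrbitMatrix

/-- **A plain `ρ = 1` orbit matrix carries structured `f = 10` data.** -/
theorem exists_flagTenOrbitData_of_plain {M : FRow 1 → FCol 1 → ℕ} (h : IsFlagOrbitMatrix 1 M) : ∃ D : FlagTenOrbitData, IsFlagTenOrbitMatrix D :=
  ⟨_, IsFlagOrbitMatrix.isFlagTenOrbitMatrix_tenDataOfPlain h⟩

/-- **The structured `f = 10` statement implies the plain one:** `NoFlagTenOrbitMatrix → NoFlagOrbitMatrix 1`. With designs g11/g12's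
computation (`NoFlagTenOrbitMatrix` decided EMPTY outside the kernel) the plain `ρ = 1` orbit level is EMPTY as well — outside the kernel; nothing
here asserts it. -/
theorem noFlagOrbitMatrix_one_of_noFlagTenOrbitMatrix (h10 : NoFlagTenOrbitMatrix) : NoFlagOrbitMatrix 1 := by
  intro M hM
  obtain ⟨D, hD⟩ := exists_flagTenOrbitData_of_plain hM
  exact h10 D hD

end Summit.Ventures.DiscreteObjects.PP12
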